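import Summits.BirchSwinnertonDyer.BirchSwinnertonDyer.Theorems.KolyvaginRoadThreePTJumpStructuresOfMiddleExact
import Summits.BirchSwinnertonDyer.BirchSwinnertonDyer.Theorems.KolyvaginRoadThreeZhangSupplyOfPoitouTate
import HarnessLib

/-!
# Route `KolyvaginRoadThree`, deciding crux `ZhangSharpFrameAtThreeHL` (item stmt-BirchSwinnertonDyer-19574):
# PT road, step (R) part 5 — the (J) binder with genuine local conditions and S2-ENGINE's (Supply) binder `hSupply`
# from Milne I 4.10(b) FOR `E[3]` ALONE (cell `bsd-stepL`, ACCEL seat `bsd-stepL-koly3b` g10;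
# `--supports stmt-BirchSwinnertonDyer-19574`, helper)

HONEST FRAMING. Theorems only; 0 definitions, 0 named facts, 0 `sorry`, no instance attributes; CONDITIONAL on the displayed
hypotheses (`hE3` and the local line-rigidity `hboundCup`); closes nothing (T7). PARTITION: O2@3 (B10) × A1 × crux 19574 ×
stub PT's consumer chain — proves-glue.

WHAT. Twins of koly3b parts XXII (`ZhangSupply.hjump_of_poitouTate`) and XXV (`ZhangSupply.hSupply_of_poitouTate`) with the
named ∀-module fact `hPT : poitouTate_selmerStructure_duality K` replaced by `hE3` = Milne *ADT* I Thm. 4.10(b) for the ONE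
module `(E/K)[3]` and THE invariant maps at level `3` (all admissible `S ⊇ ∞`; the conclusion shape of the owner's descent
certificate `KolyvaginRoadThreePT.middleExact_canonical_of_descentData`). Proof bodies verbatim, the (J) binder now from
part 4 (`PTAt.hjump_of_localLagrangians_of_middleExact`); the two local-instance attributes of parts XXII ∕ XXV (finiteness
of `E[3]`, compactness of the local absolute Galois groups for the cup products) are `Prop`-valued instance binders ∕ a
`haveI` here. Note that part XXV's OTHER use of Poitou–Tate — the perfect family with the reciprocity vanishing for the
totally complex `K` (`poitouTate_sum_localTatePairing_eq_zero_of_isTotallyComplex`) — is a tree THEOREM, untouched.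

References: [cite: WZhang2014, Lemma 8.2, Lemma 8.4] [cite: McCallumLMS1991, Prop. 2.1, Lemma 5.3] [cite: MilneADT2006,
Ch. I, Cor. 2.3, Thm. 4.10] [cite: GrossLMS1991, Prop. 8.1–8.2] [cite: Howard2004HeegnerKolyvagin, Thm. 2.1.11].
-/

noncomputable section

open scoped Classical Pointwise

universe u

namespace Summit.BirchSwinnertonDyer.Rank1Residual.X11b.Three.Koly.PTAt

open CategoryTheory WeierstrassCurve Field Function NumberField IsDedekindDomain
open Literature.NumberTheory.EllipticCurves Literature.NumberTheory.EllipticCurves.ModularForms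
  Literature.NumberTheory.GaloisRepresentations Module
open Literature.NumberTheory.GaloisRepresentations.DiscreteGaloisModule (mu MuCarrier tateDual localTatePairingZMod
  unramifiedSubgroup)
open Literature.NumberTheory.GaloisCohomology
open Summit.BirchSwinnertonDyer.Rank1Residual.X11b.Three.Koly.Method2
open Summit.BirchSwinnertonDyer.Rank1Residual.X11b.Three.Koly.Method2.KolyLocal
open Summit.BirchSwinnertonDyer.Rank1Residual.GaloisImage
open Summit.BirchSwinnertonDyer.Rank1Residual.X11b.Three.Koly.ZhangSupply
open scoped ContRepresentation

variable (W : WeierstrassCurve ℚ) (K : Type) [Field K] [NumberField K] [W.IsElliptic] [W.IsGloballyMinimal]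

/-! ## §1 The (J) binder `hjump` with the genuine ordinary ∕ transverse conditions -/

/-- **The (J) binder `hjump` of `supply_signed_of_jump_bound` from Milne I 4.10(b) for `E[3]` alone** — twin of part
XXII's `hjump_of_poitouTate`: the ORDINARY-side clauses of part 4's `hjump_of_localLagrangians_of_middleExact` discharged
by `Method2.ordinaryLocalCondition` (parts XIX–XX) and the TRANSVERSE-side clauses by `Method2.transverseLocalCondition`
(parts XXI–XXII). Frame: `K` imaginary quadratic with `d_K < −4`. [cite: WZhang2014, Lemma 8.2] [cite: McCallumLMS1991,
Prop. 2.1] [cite: MilneADT2006, Ch. I, Thm. 4.10] -/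
theorem hjump_of_middleExact (hK : IsImaginaryQuadratic K) (hd : NumberField.discr K < -4)
    [Finite ((W.baseChange K).geomTorsion ((3 ^ 1 : ℕ) : ℤ))]
    (hE3 : ∀ S : Finset (Place K), (∀ w : InfinitePlace K, (Sum.inl w : Place K) ∈ S) →
      (∀ v : HeightOneSpectrum (𝓞 K), (Sum.inr v : Place K) ∉ S →
        (((3 ^ 1 : ℕ) : ℕ) : 𝓞 K) ∉ v.asIdeal ∧
          GaloisRep.IsUnramifiedAt v ((W.baseChange K).torsionGaloisModule ((3 ^ 1 : ℕ) : ℤ))) →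
      ∀ t : Π v : Place K, galoisCohomology (((W.baseChange K).torsionGaloisModule ((3 ^ 1 : ℕ) : ℤ)).toLocal v) 1,
        (∀ y : galoisCohomology (((W.baseChange K).torsionGaloisModule ((3 ^ 1 : ℕ) : ℤ)).tateDual (3 ^ 1 : ℕ)) 1,
          (∀ v : HeightOneSpectrum (𝓞 K), (Sum.inr v : Place K) ∉ S →
            galoisCohomology.localization (((W.baseChange K).torsionGaloisModule ((3 ^ 1 : ℕ) : ℤ)).tateDual
              (3 ^ 1 : ℕ)) (Sum.inr v) 1 y ∈
              unramifiedSubgroup (GaloisRep.toLocal v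
                (((W.baseChange K).torsionGaloisModule ((3 ^ 1 : ℕ) : ℤ)).tateDual (3 ^ 1 : ℕ))) 1) →
          ∑ v ∈ S, localTatePairingZMod ((W.baseChange K).torsionGaloisModule ((3 ^ 1 : ℕ) : ℤ)) (3 ^ 1 : ℕ) v
            (LocalInvariants.canonical K (3 ^ 1 : ℕ) v) (t v)
            (galoisCohomology.localization (((W.baseChange K).torsionGaloisModule ((3 ^ 1 : ℕ) : ℤ)).tateDual
              (3 ^ 1 : ℕ)) v 1 y) = 0) →
        ∃ x : galoisCohomology ((W.baseChange K).torsionGaloisModule ((3 ^ 1 : ℕ) : ℤ)) 1,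
          (∀ v : HeightOneSpectrum (𝓞 K), (Sum.inr v : Place K) ∉ S →
            galoisCohomology.localization ((W.baseChange K).torsionGaloisModule ((3 ^ 1 : ℕ) : ℤ)) (Sum.inr v) 1 x ∈
              unramifiedSubgroup (GaloisRep.toLocal v ((W.baseChange K).torsionGaloisModule ((3 ^ 1 : ℕ) : ℤ))) 1) ∧
          ∀ v ∈ S, galoisCohomology.localization ((W.baseChange K).torsionGaloisModule ((3 ^ 1 : ℕ) : ℤ)) v 1 x = t v)
    (ι : K →+* ℂ)
    (plK : {ℓ // Zhang2014.IsKolyvaginPrime (W.conductorNorm ℤ) W K 3 ℓ} → HeightOneSpectrum (𝓞 K))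
    (hplK : ∀ ℓ, ((ℓ : ℕ) : 𝓞 K) ∈ (plK ℓ).asIdeal) :
    ∀ (n : Finset {q // IsUAdmissiblePrime W K q}), GoodLevel W K n → n.Nonempty →
      ∀ (ℓ : {ℓ // Zhang2014.IsKolyvaginPrime (W.conductorNorm ℤ) W K 3 ℓ}) (T : Finset _), ℓ ∉ T →
      ∀ x₀ : V3 W K, ∃ x : V3 W K,
        ((∀ w : InfinitePlace K, x ∈ selmerLocalKer (W.baseChange K) w.Completion ((3 ^ 1 : ℕ) : ℤ)) ∧
          (∀ v : HeightOneSpectrum (𝓞 K), v ≠ plK ℓ → (∀ ℓ' ∈ T, plK ℓ' ≠ v) →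
            ((∀ q ∈ n, ((q : ℕ) : 𝓞 K) ∉ v.asIdeal) →
              x ∈ selmerLocalKer (W.baseChange K) (v.adicCompletion K) ((3 ^ 1 : ℕ) : ℤ)) ∧
            (∀ q ∈ n, ((q : ℕ) : 𝓞 K) ∈ v.asIdeal →
              x ∈ (W.baseChange K).ordinaryLocalKer (v.adicCompletion K) ((3 ^ 1 : ℕ) : ℤ))) ∧
          (∀ ℓ' ∈ T, x ∈ transverseLocalKer W K ι ℓ' (plK ℓ'))) ∧
        ∀ a : ℤ, x - a • x₀ ∉ (W.baseChange K).torsionLocalKer ((plK ℓ).adicCompletion K) ((3 ^ 1 : ℕ) : ℤ) := by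
  have hinj := plK_injective W K plK hplK
  -- the two families of genuine local conditions
  let Lord : (v : HeightOneSpectrum (𝓞 K)) →
      AddSubgroup (galoisCohomology (((W.baseChange K).torsionGaloisModule ((3 ^ 1 : ℕ) : ℤ)).toLocal (Sum.inr v)) 1) :=
    fun v ↦ ordinaryLocalCondition (W.baseChange K) (v.adicCompletion K) ((3 ^ 1 : ℕ) : ℤ)
  let Ltr : (v : HeightOneSpectrum (𝓞 K)) →
      AddSubgroup (galoisCohomology (((W.baseChange K).torsionGaloisModule ((3 ^ 1 : ℕ) : ℤ)).toLocal (Sum.inr v)) 1) :=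
    fun v ↦ if h : ∃ ℓ', plK ℓ' = v then
      transverseLocalCondition (W.baseChange K) ι (Classical.choose h).1 (v.adicCompletion K) ((3 ^ 1 : ℕ) : ℤ) else ⊥
  have hLtr : ∀ ℓ', Ltr (plK ℓ') = transverseLocalCondition (W.baseChange K) ι ℓ'.1 ((plK ℓ').adicCompletion K)
      ((3 ^ 1 : ℕ) : ℤ) := by
    intro ℓ'
    have h : ∃ ℓ'', plK ℓ'' = plK ℓ' := ⟨ℓ', rfl⟩
    have hc : Classical.choose h = ℓ' := hinj (Classical.choose_spec h)
    simp only [Ltr, dif_pos h]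
    rw [hc]
  haveI : ∀ v : Place K, CompactSpace (absoluteGaloisGroup (Place.Completion v)) :=
    fun v ↦ absoluteGaloisGroup_compactSpace _
  refine PTAt.hjump_of_localLagrangians_of_middleExact W K ι hK hE3 plK hplK Lord Ltr
    (fun q hq v hqv e hμ hadd₁ hadd₂ halt _ hgal ↦ hordIso_ordinaryLocalCondition W K hK q hq v hqv e hμ hadd₁ hadd₂ halt hgal)
    (fun q hq v hqv ↦ hordCard_ordinaryLocalCondition W K hK q hq v hqv)
    (fun q _ v _ x hx ↦ hordIncl_ordinaryLocalCondition W K v x hx)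
    (fun ℓ' e hμ hadd₁ hadd₂ _ _ hgal a ha b hb ↦ ?_) (fun ℓ' ↦ ?_) (fun ℓ' x hx ↦ ?_)
  · rw [hLtr] at ha hb
    exact htrIso_transverseLocalCondition W K hK hd ι ℓ'.2 (plK ℓ') (hplK ℓ') e hμ hadd₁ hadd₂ hgal a ha b hb
  · rw [hLtr]
    exact htrCard_transverseLocalCondition W K hK hd ι ℓ'.2 (plK ℓ') (hplK ℓ')
  · rw [hLtr] at hx
    exact htrIncl_transverseLocalCondition W K hK ι ℓ'.2 (plK ℓ') (hplK ℓ') x hx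

/-! ## §2 S2-ENGINE's (Supply) binder `hSupply` -/

/-- **S2-ENGINE's (Supply) binder `hSupply` from Milne I 4.10(b) for `E[3]` alone, modulo (IsoBound) in cup-product
currency** — twin of part XXV's `hSupply_of_poitouTate` (same frame, same local input `hboundCup`; assembly = part XIII
`supply_signed_of_jump_bound` with p508963's apparatus and `hjump := hjump_of_middleExact`). [cite: WZhang2014, Lemma 8.2]
[cite: McCallumLMS1991, Prop. 2.1] [cite: MilneADT2006, Ch. I, Cor. 2.3, Thm. 4.10] -/
theorem hSupply_of_middleExact [Module (ZMod 3) (V3 W K)] (ι : K →+* ℂ) (c : K ≃ₐ[ℚ] K)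
    (hK : IsImaginaryQuadratic K) (hd : NumberField.discr K < -4) (hc : c ≠ 1)
    [Finite ((W.baseChange K).geomTorsion ((3 ^ 1 : ℕ) : ℤ))]
    [∀ v : Place K, CompactSpace (absoluteGaloisGroup (Place.Completion v))]
    (hE3 : ∀ S : Finset (Place K), (∀ w : InfinitePlace K, (Sum.inl w : Place K) ∈ S) →
      (∀ v : HeightOneSpectrum (𝓞 K), (Sum.inr v : Place K) ∉ S →
        (((3 ^ 1 : ℕ) : ℕ) : 𝓞 K) ∉ v.asIdeal ∧
          GaloisRep.IsUnramifiedAt v ((W.baseChange K).torsionGaloisModule ((3 ^ 1 : ℕ) : ℤ))) →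
      ∀ t : Π v : Place K, galoisCohomology (((W.baseChange K).torsionGaloisModule ((3 ^ 1 : ℕ) : ℤ)).toLocal v) 1,
        (∀ y : galoisCohomology (((W.baseChange K).torsionGaloisModule ((3 ^ 1 : ℕ) : ℤ)).tateDual (3 ^ 1 : ℕ)) 1,
          (∀ v : HeightOneSpectrum (𝓞 K), (Sum.inr v : Place K) ∉ S →
            galoisCohomology.localization (((W.baseChange K).torsionGaloisModule ((3 ^ 1 : ℕ) : ℤ)).tateDual
              (3 ^ 1 : ℕ)) (Sum.inr v) 1 y ∈
              unramifiedSubgroup (GaloisRep.toLocal v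
                (((W.baseChange K).torsionGaloisModule ((3 ^ 1 : ℕ) : ℤ)).tateDual (3 ^ 1 : ℕ))) 1) →
          ∑ v ∈ S, localTatePairingZMod ((W.baseChange K).torsionGaloisModule ((3 ^ 1 : ℕ) : ℤ)) (3 ^ 1 : ℕ) v
            (LocalInvariants.canonical K (3 ^ 1 : ℕ) v) (t v)
            (galoisCohomology.localization (((W.baseChange K).torsionGaloisModule ((3 ^ 1 : ℕ) : ℤ)).tateDual
              (3 ^ 1 : ℕ)) v 1 y) = 0) →
        ∃ x : galoisCohomology ((W.baseChange K).torsionGaloisModule ((3 ^ 1 : ℕ) : ℤ)) 1,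
          (∀ v : HeightOneSpectrum (𝓞 K), (Sum.inr v : Place K) ∉ S →
            galoisCohomology.localization ((W.baseChange K).torsionGaloisModule ((3 ^ 1 : ℕ) : ℤ)) (Sum.inr v) 1 x ∈
              unramifiedSubgroup (GaloisRep.toLocal v ((W.baseChange K).torsionGaloisModule ((3 ^ 1 : ℕ) : ℤ))) 1) ∧
          ∀ v ∈ S, galoisCohomology.localization ((W.baseChange K).torsionGaloisModule ((3 ^ 1 : ℕ) : ℤ)) v 1 x = t v)
    (plK : {ℓ // Zhang2014.IsKolyvaginPrime (W.conductorNorm ℤ) W K 3 ℓ} → HeightOneSpectrum (𝓞 K))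
    (hplK : ∀ ℓ, ((ℓ : ℕ) : 𝓞 K) ∈ (plK ℓ).asIdeal)
    (hboundCup : ∀ (e : geomTorsion (W.baseChange K) ((3 ^ 1 : ℕ) : ℤ) → geomTorsion (W.baseChange K) ((3 ^ 1 : ℕ) : ℤ) →
          AlgebraicClosure K)
        (hμ : ∀ P Q, e P Q ^ (3 ^ 1) = 1) (hadd₁ : ∀ P₁ P₂ Q, e (P₁ + P₂) Q = e P₁ Q * e P₂ Q)
        (hadd₂ : ∀ P Q₁ Q₂, e P (Q₁ + Q₂) = e P Q₁ * e P Q₂) (_halt : ∀ Q, e Q Q = 1)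
        (_hnondeg : ∀ Q, (∀ P, e P Q = 1) → Q = 0)
        (hgal : ∀ (σ : absoluteGaloisGroup K) (P Q : geomTorsion (W.baseChange K) ((3 ^ 1 : ℕ) : ℤ)),
          σ • e P Q = e (σ • P) (σ • Q))
        (ℓ : {ℓ // Zhang2014.IsKolyvaginPrime (W.conductorNorm ℤ) W K 3 ℓ}) (s : Bool) (x y : V3 W K),
      conjAct W c ((3 ^ 1 : ℕ) : ℤ) x = sgn s • x → conjAct W c ((3 ^ 1 : ℕ) : ℤ) y = sgn s • y →
      (weilContPairingLocal (W.baseChange K) (3 ^ 1) e hμ hadd₁ hadd₂ hgal (Sum.inr (plK ℓ))).cupProduct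
        (galoisCohomology.localization ((W.baseChange K).torsionGaloisModule ((3 ^ 1 : ℕ) : ℤ)) (Sum.inr (plK ℓ)) 1 x)
        (galoisCohomology.localization ((W.baseChange K).torsionGaloisModule ((3 ^ 1 : ℕ) : ℤ)) (Sum.inr (plK ℓ)) 1 x)
          = 0 →
      (weilContPairingLocal (W.baseChange K) (3 ^ 1) e hμ hadd₁ hadd₂ hgal (Sum.inr (plK ℓ))).cupProduct
        (galoisCohomology.localization ((W.baseChange K).torsionGaloisModule ((3 ^ 1 : ℕ) : ℤ)) (Sum.inr (plK ℓ)) 1 x)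
        (galoisCohomology.localization ((W.baseChange K).torsionGaloisModule ((3 ^ 1 : ℕ) : ℤ)) (Sum.inr (plK ℓ)) 1 y)
          = 0 →
      (weilContPairingLocal (W.baseChange K) (3 ^ 1) e hμ hadd₁ hadd₂ hgal (Sum.inr (plK ℓ))).cupProduct
        (galoisCohomology.localization ((W.baseChange K).torsionGaloisModule ((3 ^ 1 : ℕ) : ℤ)) (Sum.inr (plK ℓ)) 1 y)
        (galoisCohomology.localization ((W.baseChange K).torsionGaloisModule ((3 ^ 1 : ℕ) : ℤ)) (Sum.inr (plK ℓ)) 1 x)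
          = 0 →
      (weilContPairingLocal (W.baseChange K) (3 ^ 1) e hμ hadd₁ hadd₂ hgal (Sum.inr (plK ℓ))).cupProduct
        (galoisCohomology.localization ((W.baseChange K).torsionGaloisModule ((3 ^ 1 : ℕ) : ℤ)) (Sum.inr (plK ℓ)) 1 y)
        (galoisCohomology.localization ((W.baseChange K).torsionGaloisModule ((3 ^ 1 : ℕ) : ℤ)) (Sum.inr (plK ℓ)) 1 y)
          = 0 →
      x ∉ (W.baseChange K).torsionLocalKer ((plK ℓ).adicCompletion K) ((3 ^ 1 : ℕ) : ℤ) →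
      ∃ a : ℤ, y - a • x ∈ (W.baseChange K).torsionLocalKer ((plK ℓ).adicCompletion K) ((3 ^ 1 : ℕ) : ℤ)) :
    ∀ (n : Finset {q // IsUAdmissiblePrime W K q}), GoodLevel W K n → n.Nonempty →
      ∀ (ℓ : {ℓ // Zhang2014.IsKolyvaginPrime (W.conductorNorm ℤ) W K 3 ℓ}) (T : Finset _), ℓ ∉ T →
      ∀ s : Bool, ∃ x : V3 W K, conjAct W c ((3 ^ 1 : ℕ) : ℤ) x = sgn s • x ∧ x ≠ 0 ∧
        (∀ w : InfinitePlace K, x ∈ selmerLocalKer (W.baseChange K) w.Completion ((3 ^ 1 : ℕ) : ℤ)) ∧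
        (∀ v : HeightOneSpectrum (𝓞 K), v ≠ plK ℓ → (∀ ℓ' ∈ T, plK ℓ' ≠ v) →
          ((∀ q ∈ n, ((q : ℕ) : 𝓞 K) ∉ v.asIdeal) →
            x ∈ selmerLocalKer (W.baseChange K) (v.adicCompletion K) ((3 ^ 1 : ℕ) : ℤ)) ∧
          (∀ q ∈ n, ((q : ℕ) : 𝓞 K) ∈ v.asIdeal →
            x ∈ (W.baseChange K).ordinaryLocalKer (v.adicCompletion K) ((3 ^ 1 : ℕ) : ℤ))) ∧
        (∀ ℓ' ∈ T, x ∈ transverseLocalKer W K ι ℓ' (plK ℓ')) := by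
  haveI : IsTotallyComplex K := hK.2
  haveI : Fact (Nat.Prime (3 ^ 1)) := ⟨by norm_num⟩
  haveI : NeZero (3 ^ 1 : ℕ) := ⟨by norm_num⟩
  -- the `ZMod 3`-structure of the local cohomology groups
  have hV3 : ∀ (v : Place K) (x : galoisCohomology (((W.baseChange K).torsionGaloisModule ((3 ^ 1 : ℕ) :
      ℤ)).toLocal v) 1), 3 • x = 0 := fun v x ↦
    galoisCohomology.nsmul_eq_zero_of_forall (((W.baseChange K).torsionGaloisModule ((3 ^ 1 : ℕ) : ℤ)).toLocal v)
      (n := 3 ^ 1) (fun m => AddSubgroup.torsionBy.nsmul m) x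
  letI : ∀ v : Place K, Module (ZMod 3) (galoisCohomology (((W.baseChange K).torsionGaloisModule ((3 ^ 1 : ℕ) :
      ℤ)).toLocal v) 1) := fun v ↦ AddCommGroup.zmodModule (hV3 v)
  -- the localisations, a Weil pairing, the Poitou–Tate family, the local forms
  obtain ⟨loc, hloc⟩ := exists_zmodLinear_localization W K
  obtain ⟨e, hμ, hadd₁, hadd₂, halt, hnondeg, hgal⟩ :=
    exists_weilPairing_holds (W.baseChange K) (3 ^ 1) (by norm_num) (by norm_num)
  obtain ⟨inv, hinvperf, hPTsum⟩ := poitouTate_sum_localTatePairing_eq_zero_of_isTotallyComplex K (3 ^ 1)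
  obtain ⟨b, hb⟩ := exists_zmodBilinear_invCupProduct W K e hμ hadd₁ hadd₂ hgal inv
  have hrec : ∀ (x y : V3 W K) (T : Finset (Place K)), (∀ v, v ∉ T → b v (loc v x) (loc v y) = 0) →
      ∑ v ∈ T, b v (loc v x) (loc v y) = 0 := fun x y T hT ↦ sum_invCupProduct_eq_zero W K hb hloc hPTsum x y T hT
  have hisoKum := fun v ↦ invCupProduct_eq_zero_of_mem_kummer W K hb halt v
  have hisoOrd : ∀ (q : {q // IsUAdmissiblePrime W K q}), FrobSqNeOneAt W 3 q.1 →
      ∀ (v : HeightOneSpectrum (𝓞 K)), ((q : ℕ) : 𝓞 K) ∈ v.asIdeal → ∀ (x y : V3 W K),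
      x ∈ (W.baseChange K).ordinaryLocalKer (v.adicCompletion K) ((3 ^ 1 : ℕ) : ℤ) →
      y ∈ (W.baseChange K).ordinaryLocalKer (v.adicCompletion K) ((3 ^ 1 : ℕ) : ℤ) →
      b (Sum.inr v) (loc (Sum.inr v) x) (loc (Sum.inr v) y) = 0 :=
    fun q hq v hqv x y hx hy ↦ invCupProduct_eq_zero_of_mem_ordinary W K hb hloc hK halt q hq v hqv x y hx hy
  have hinj : ∀ v : HeightOneSpectrum (𝓞 K), Injective (inv (Sum.inr v)) := fun v ↦ (hinvperf v).1.1
  have hisoTr : ∀ (ℓ : {ℓ // Zhang2014.IsKolyvaginPrime (W.conductorNorm ℤ) W K 3 ℓ}) (x y : V3 W K),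
      x ∈ transverseLocalKer W K ι ℓ (plK ℓ) → y ∈ transverseLocalKer W K ι ℓ (plK ℓ) →
      b (Sum.inr (plK ℓ)) (loc (Sum.inr (plK ℓ)) x) (loc (Sum.inr (plK ℓ)) y) = 0 := by
    intro ℓ x y hx hy
    rw [hb, hloc, hloc, KolyLocal.cupProduct_eq_zero_of_mem_transverseLocalKer W K hK ι e hμ hadd₁ hadd₂ hgal ℓ.2
      (plK ℓ) (hplK ℓ) hx hy]
    exact map_zero _
  have hjump := hjump_of_middleExact W K hK hd hE3 ι plK hplK
  -- (IsoBound) in `b`-currency from the cup-product currency (`inv_λ` is injective)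
  have hcup0 : ∀ (ℓ : {ℓ // Zhang2014.IsKolyvaginPrime (W.conductorNorm ℤ) W K 3 ℓ}) (x y : V3 W K),
      b (Sum.inr (plK ℓ)) (loc (Sum.inr (plK ℓ)) x) (loc (Sum.inr (plK ℓ)) y) = 0 →
      (weilContPairingLocal (W.baseChange K) (3 ^ 1) e hμ hadd₁ hadd₂ hgal (Sum.inr (plK ℓ))).cupProduct
        (galoisCohomology.localization ((W.baseChange K).torsionGaloisModule ((3 ^ 1 : ℕ) : ℤ)) (Sum.inr (plK ℓ)) 1 x)
        (galoisCohomology.localization ((W.baseChange K).torsionGaloisModule ((3 ^ 1 : ℕ) : ℤ)) (Sum.inr (plK ℓ)) 1 y)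
          = 0 := by
    intro ℓ x y h
    rw [hb, hloc, hloc] at h
    exact hinj _ (h.trans (map_zero _).symm)
  have hbound : ∀ (ℓ : {ℓ // Zhang2014.IsKolyvaginPrime (W.conductorNorm ℤ) W K 3 ℓ}) (s : Bool) (x y : V3 W K),
      conjAct W c ((3 ^ 1 : ℕ) : ℤ) x = sgn s • x → conjAct W c ((3 ^ 1 : ℕ) : ℤ) y = sgn s • y →
      b (Sum.inr (plK ℓ)) (loc (Sum.inr (plK ℓ)) x) (loc (Sum.inr (plK ℓ)) x) = 0 →
      b (Sum.inr (plK ℓ)) (loc (Sum.inr (plK ℓ)) x) (loc (Sum.inr (plK ℓ)) y) = 0 →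
      b (Sum.inr (plK ℓ)) (loc (Sum.inr (plK ℓ)) y) (loc (Sum.inr (plK ℓ)) x) = 0 →
      b (Sum.inr (plK ℓ)) (loc (Sum.inr (plK ℓ)) y) (loc (Sum.inr (plK ℓ)) y) = 0 →
      x ∉ (W.baseChange K).torsionLocalKer ((plK ℓ).adicCompletion K) ((3 ^ 1 : ℕ) : ℤ) →
      ∃ a : ℤ, y - a • x ∈ (W.baseChange K).torsionLocalKer ((plK ℓ).adicCompletion K) ((3 ^ 1 : ℕ) : ℤ) :=
    fun ℓ s x y hxs hys h11 h12 h21 h22 hx0 ↦ hboundCup e hμ hadd₁ hadd₂ halt hnondeg hgal ℓ s x y hxs hys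
      (hcup0 ℓ x x h11) (hcup0 ℓ x y h12) (hcup0 ℓ y x h21) (hcup0 ℓ y y h22) hx0
  exact supply_signed_of_jump_bound W K ι c hK hc loc hloc plK hplK b hrec hisoKum hisoOrd hisoTr hjump hbound

end Summit.BirchSwinnertonDyer.Rank1Residual.X11b.Three.Koly.PTAt

end
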